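import Summits.ResolutionOfSingularities.ResolutionOfSingularities.Theorems.FrobeniusClosingPatchingRelPerfectChartStrictExceptional
import HarnessLib

/-!
# Crux `PatchingRelPerfect` (stmt-ResolutionOfSingularities-16161), chain w52 — rung toolkit:
# the strict transform of a HYPERSURFACE through the centre, cut by the strict transform of the
# old exceptional divisor (brick 7)

[OURS · L1 W5.2 · rung tool] Setting of `…ChartStrictExceptional` (brick 2): `A` a ring,
`c = (t, v₁, …, v_m)` quasi-regular with `A/(c)` a domain, `C` the `v_k`-chart of `Bl_{(c)} Spec A`
with exceptional parameter `w` and strict transform `u' = e'₀` of `t`.  NEW: a hypersurface `r ∈ A`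
whose total transform factors as `φ(r) = wⁿ · g` on the chart.  Reading `C/(u') ≅ (A/(t))[(c̄)/v̄_k]`
(brick 2) and applying the strict-transform-of-a-hypersurface presentation
(`blowupAlgebra.quotientKerMapQuotientEquiv`, Görtz–Wedhorn 13.96 (2)) a SECOND time, to `r̄` on
`A/(t)`, gives `C/(u', g) ≅ (A/(t, r))[(c̄)/v̄_k]`.  PROVED:

* `strictHyp_isDomain_quot_sup` — `C ⧸ ((w) + (u'))` is a domain (a polynomial ring over `A/(c)`);
* `strictHyp_factor`, `strictHyp_prime`, `strictHyp_not_dvd` — the three inputs of the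
  presentation on `A/(t)` (`v̄_k` is prime in `(A/(t))[(c̄)/v̄_k]` because the quotient is
  `C/(w, u')`; `v̄_k ∤ ḡ` because `g ∉ (w, u')`);
* `strictHyp_exists_equiv₂`, `strictHyp_mk_comp_psi` — the presentation
  `C ⧸ (u', g) ≅ (A/(t))[(c̄)/v̄_k] ⧸ (ḡ) ≅ (A/(t, r))[(c̄)/v̄_k]` (`w ↦ v̄_k`);
* **`strictHyp_isDomain_quot_pair`** — `C ⧸ (u', g)` is a domain when `A/(t, r)` is a domain and
  `v_k ∉ (t, r)`; **`strictHyp_chartBase_notMem_pair`** — then also `w ∉ (u', g)`.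

These are the hypotheses `R/(c, o)` integral and `ℓ ∉ (c, o)` of the letter tower
(`…LetterTower`, `H''`) at the vertex charts of the contact-migration member, where `o = G` is the
strict transform of the quadric cone (this seat's PLAN-A2-certificate.md, addendum 5 (3)).
Arbitrary rings; nothing here is a statement of the manuscript under review.

## References

* U. Görtz, T. Wedhorn, *Algebraic Geometry I*, 2nd ed. 2020, Prop. 13.96 (2) and p. 416; (13.19).
  [GortzWedhorn2020]
* The Stacks Project, Tags 0804, 0BIQ. [StacksProject]
-/

-- `Summit.<Summit>.<Sub>.Theorems` with `Sub = Summit` (single-conjunct summit, D-0017)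
set_option linter.dupNamespace false

noncomputable section

open CategoryTheory CategoryTheory.Limits AlgebraicGeometry Literature.AlgebraicGeometry.Resolution
open IsLocalRing

namespace Summit.ResolutionOfSingularities.ResolutionOfSingularities.Theorems

namespace ConeRung

universe u

section StrictHypersurface

variable {A : Type u} [CommRing A] {m : ℕ} (t : A) (v : Fin m → A) (k : Fin m)

local notation3 "cc" => (Fin.cons t v : Fin (m + 1) → A)
local notation3 "II" => Ideal.span (Set.range (Fin.cons t v : Fin (m + 1) → A))
/-- the `v_k`-chart `C` of `Bl_{(c)} Spec A`, its structure map, exceptional parameter `w` and the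
strict transform `u' = e'₀` of `t` -/
local notation3 "C" => chartRing cc (Fin.succ k)
local notation3 "ψ" => chartBase cc (Fin.succ k)
local notation3 "w" => chartBase cc (Fin.succ k) (cc (Fin.succ k))
local notation3 "u'" => chartGen cc (Fin.succ k) 0
/-- the affine blowup algebra model `A[(c)/v_k] ⊆ A[1/v_k]` and the comparison isomorphism -/
local notation3 "RR" => blowupAlgebra (Ideal.span (Set.range (Fin.cons t v : Fin (m + 1) → A)))
  ((Fin.cons t v : Fin (m + 1) → A) (Fin.succ k))
local notation3 "Φ" => reesChartEquiv (I := Ideal.span (Set.range (Fin.cons t v : Fin (m + 1) → A)))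
  ((Fin.cons t v : Fin (m + 1) → A) (Fin.succ k))
  (Ideal.mem_span_range_self (f := (Fin.cons t v : Fin (m + 1) → A)) (x := Fin.succ k))
/-- one level down: `A₁ = A/(t)`, `(A/(t))[(c̄)/v̄_k]` and the reduction map `θ` -/
local notation3 "π₁" => Ideal.Quotient.mk (Ideal.span {t})
local notation3 "RR₁" => blowupAlgebra
  ((Ideal.span (Set.range (Fin.cons t v : Fin (m + 1) → A))).map (Ideal.Quotient.mk (Ideal.span {t})))
  (Ideal.Quotient.mk (Ideal.span {t}) ((Fin.cons t v : Fin (m + 1) → A) (Fin.succ k)))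
local notation3 "θ" => blowupAlgebra.mapQuotient
  (Ideal.span (Set.range (Fin.cons t v : Fin (m + 1) → A)))
  ((Fin.cons t v : Fin (m + 1) → A) (Fin.succ k)) (Ideal.span {t})

/-- the reduction map `Ψ = θ ∘ Φ : C → (A/(t))[(c̄)/v̄_k]` -/
local notation3 "Ψ" => (blowupAlgebra.mapQuotient
  (Ideal.span (Set.range (Fin.cons t v : Fin (m + 1) → A)))
  ((Fin.cons t v : Fin (m + 1) → A) (Fin.succ k)) (Ideal.span {t})).comp
  ((reesChartEquiv (I := Ideal.span (Set.range (Fin.cons t v : Fin (m + 1) → A)))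
    ((Fin.cons t v : Fin (m + 1) → A) (Fin.succ k))
    (Ideal.mem_span_range_self (f := (Fin.cons t v : Fin (m + 1) → A)) (x := Fin.succ k)) :
      chartRing (Fin.cons t v : Fin (m + 1) → A) (Fin.succ k) →+*
        blowupAlgebra (Ideal.span (Set.range (Fin.cons t v : Fin (m + 1) → A)))
          ((Fin.cons t v : Fin (m + 1) → A) (Fin.succ k))))

/-! ## `C ⧸ ((w) + (u'))` is a domain -/

/-- `C ⧸ ((w) + (u'))` is a polynomial ring over the domain `A/(c)`, hence a domain.
[cite: StacksProject, Tag 0BIQ] -/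
theorem strictHyp_isDomain_quot_sup (hc : IsQuasiRegular cc) [IsDomain (A ⧸ II)] :
    IsDomain (C ⧸ (Ideal.span {w} ⊔ Ideal.span {u'})) := by
  haveI : IsDomain (A ⧸ ((II) ⊔ ⊥)) := by rw [sup_bot_eq]; infer_instance
  have h0 : Fin.succ k ∉ ({0} : Set (Fin (m + 1))) := by
    rw [Set.mem_singleton_iff]; exact Fin.succ_ne_zero k
  have hI : chartStageIdeal cc (Fin.succ k) ⊥ {0} = Ideal.span {w} ⊔ Ideal.span {u'} := by
    rw [chartStageIdeal, Ideal.map_bot, sup_bot_eq, Set.image_singleton]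
  exact MulEquiv.isDomain _ ((Ideal.quotEquivOfEq hI.symm).trans
    (chartStageEquiv cc (Fin.succ k) ⊥ {0} hc h0).symm).toMulEquiv

/-! ## The three inputs of the second strict-transform presentation -/

/-- A ring map on `aⁿ b` (generic rings; used to push chart identities through `Ψ` without
rewriting inside the chart ring). [folklore] -/
theorem ringHom_map_pow_mul {X Y : Type*} [Semiring X] [Semiring Y] (f : X →+* Y) (a b : X)
    (n : ℕ) : f (a ^ n * b) = f a ^ n * f b := by
  rw [map_mul, map_pow]

/-- `Ψ` on the structure map: `Ψ (φ a) = ā`. [folklore] -/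
theorem strictHyp_psi_chartBase (a : A) :
    Ψ (ψ a) = algebraMap (A ⧸ Ideal.span {t}) RR₁ (π₁ a) := by
  rw [RingHom.comp_apply, RingHom.coe_coe, strictExc_equiv_chartBase,
    blowupAlgebra.mapQuotient_algebraMap]

/-- `Ψ w = v̄_k` in `(A/(t))[(c̄)/v̄_k]`. [folklore] -/
theorem strictHyp_psi_w :
    Ψ w = algebraMap (A ⧸ Ideal.span {t}) RR₁ (π₁ (cc (Fin.succ k))) :=
  strictHyp_psi_chartBase t v k _

/-- **The factorisation one level down**: if `φ(r) = wⁿ g` then `r̄ = v̄_kⁿ · Ψ g` in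
`(A/(t))[(c̄)/v̄_k]`. [folklore] -/
theorem strictHyp_factor {r : A} {g : C} {n : ℕ} (hg : ψ r = w ^ n * g) :
    algebraMap (A ⧸ Ideal.span {t}) RR₁ (π₁ r) =
      algebraMap (A ⧸ Ideal.span {t}) RR₁ (π₁ (cc (Fin.succ k))) ^ n * Ψ g := by
  have h := ringHom_map_pow_mul Ψ w g n
  rw [strictHyp_psi_w] at h
  rw [← strictHyp_psi_chartBase t v k r, hg]
  exact h

/-- The kernel of the (surjective) reduction `Ψ` is `(u')`. [cite: GortzWedhorn2020, Prop. 13.96 (2) and p. 416] -/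
theorem strictHyp_ker_psi (hc : IsQuasiRegular cc) [IsDomain (A ⧸ II)] :
    RingHom.ker Ψ = Ideal.span {u'} := by
  rw [← RingHom.comap_ker, blowupAlgebra.ker_mapQuotient_eq_span _ _ (strictExc_factor t v k)
    (strictExc_prime_algebraMap t v k hc) (strictExc_not_dvd t v k hc)]
  apply le_antisymm
  · intro y hy
    rw [Ideal.mem_comap, RingHom.coe_coe, Ideal.mem_span_singleton] at hy
    obtain ⟨z, hz⟩ := hy
    rw [Ideal.mem_span_singleton]
    refine ⟨(Φ).symm z, (Φ).injective ?_⟩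
    rw [map_mul, RingEquiv.apply_symm_apply, hz]
  · rw [Ideal.span_singleton_le_iff_mem, Ideal.mem_comap, RingHom.coe_coe]
    exact Ideal.mem_span_singleton_self _

/-- The pull-back of `(Ψ y)` along `Ψ` is `(y) + (u')`. [folklore] -/
theorem strictHyp_comap_span (hc : IsQuasiRegular cc) [IsDomain (A ⧸ II)] (y : C) :
    (Ideal.span {Ψ y}).comap Ψ = Ideal.span {y} ⊔ Ideal.span {u'} := by
  have h1 : Ideal.span {Ψ y} = (Ideal.span {y}).map Ψ := by
    rw [Ideal.map_span Ψ {y}, Set.image_singleton]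
  rw [h1, Ideal.comap_map_of_surjective Ψ
      ((blowupAlgebra.mapQuotient_surjective _ _ _).comp (Φ).surjective),
    ← RingHom.ker_eq_comap_bot, strictHyp_ker_psi t v k hc]

/-- `v̄_k ≠ 0` in `(A/(t))[(c̄)/v̄_k]` when `A/(t)` is a domain and `v_k ∉ (t)`. [folklore] -/
theorem strictHyp_algebraMap_ne_zero [IsDomain (A ⧸ Ideal.span {t})] (hvk : v k ∉ Ideal.span {t}) :
    algebraMap (A ⧸ Ideal.span {t}) RR₁ (π₁ (cc (Fin.succ k))) ≠ 0 := by
  intro h0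
  have h4 := congrArg Subtype.val h0
  rw [Subalgebra.coe_algebraMap, ZeroMemClass.coe_zero] at h4
  have hinj := IsLocalization.injective
    (Localization.Away (π₁ (cc (Fin.succ k))))
    (powers_le_nonZeroDivisors_of_noZeroDivisors (strictExc_mk_ne_zero t v k hvk))
  exact strictExc_mk_ne_zero t v k hvk (hinj (by rw [h4, map_zero]))

/-- **`v̄_k` is a prime element of `(A/(t))[(c̄)/v̄_k]`**: the quotient is `C ⧸ (w, u')`, a domain.
[cite: StacksProject, Tag 0BIQ] -/
theorem strictHyp_prime (hc : IsQuasiRegular cc) [IsDomain (A ⧸ II)]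
    [IsDomain (A ⧸ Ideal.span {t})] (hvk : v k ∉ Ideal.span {t}) :
    Prime (algebraMap (A ⧸ Ideal.span {t}) RR₁ (π₁ (cc (Fin.succ k)))) := by
  haveI := strictHyp_isDomain_quot_sup t v k hc
  -- `RR₁ ⧸ (v̄_k) ≅ C ⧸ ((w) + (u'))`
  have hΩs : Function.Surjective ((Ideal.Quotient.mk (Ideal.span {Ψ w})).comp Ψ) :=
    Ideal.Quotient.mk_surjective.comp ((blowupAlgebra.mapQuotient_surjective _ _ _).comp (Φ).surjective)
  have hΩk : RingHom.ker ((Ideal.Quotient.mk (Ideal.span {Ψ w})).comp Ψ) =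
      Ideal.span {w} ⊔ Ideal.span {u'} := by
    rw [← RingHom.comap_ker, Ideal.mk_ker, strictHyp_comap_span t v k hc]
  haveI : IsDomain (RR₁ ⧸ Ideal.span {Ψ w}) :=
    MulEquiv.isDomain (C ⧸ (Ideal.span {w} ⊔ Ideal.span {u'}))
      ((RingHom.quotientKerEquivOfSurjective hΩs).symm.trans (Ideal.quotEquivOfEq hΩk)).toMulEquiv
  rw [← strictHyp_psi_w]
  refine (Ideal.span_singleton_prime ?_).mp ((Ideal.Quotient.isDomain_iff_prime _).mp ‹_›)
  rw [strictHyp_psi_w]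
  exact strictHyp_algebraMap_ne_zero t v k hvk

/-- **`v̄_k ∤ Ψ g`** when `g ∉ (w) + (u')`. [folklore] -/
theorem strictHyp_not_dvd (hc : IsQuasiRegular cc) [IsDomain (A ⧸ II)] {g : C}
    (hgn : g ∉ Ideal.span {w} ⊔ Ideal.span {u'}) :
    ¬ algebraMap (A ⧸ Ideal.span {t}) RR₁ (π₁ (cc (Fin.succ k))) ∣ Ψ g := by
  intro hd
  apply hgn
  rw [← strictHyp_comap_span t v k hc, Ideal.mem_comap, Ideal.mem_span_singleton, strictHyp_psi_w]
  exact hd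

/-! ## The presentation `C ⧸ (u', g) ≅ (A/(t, r))[(c̄)/v̄_k]` and its consequences -/

/-- the second level down: `A₂ = (A/(t))/(r̄)` and `(A/(t, r))[(c̄)/v̄_k]` -/
local notation3 "π₂[" r "]" => Ideal.Quotient.mk (Ideal.span {Ideal.Quotient.mk (Ideal.span {t}) r})
local notation3 "RR₂[" r "]" => blowupAlgebra
  ((((Ideal.span (Set.range (Fin.cons t v : Fin (m + 1) → A))).map
    (Ideal.Quotient.mk (Ideal.span {t}))).map
    (Ideal.Quotient.mk (Ideal.span {Ideal.Quotient.mk (Ideal.span {t}) r}))))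
  (Ideal.Quotient.mk (Ideal.span {Ideal.Quotient.mk (Ideal.span {t}) r})
    (Ideal.Quotient.mk (Ideal.span {t}) ((Fin.cons t v : Fin (m + 1) → A) (Fin.succ k))))

/-- **The second strict-transform presentation** `(A/(t))[(c̄)/v̄_k] ⧸ (Ψ g) ≅ (A/(t, r))[(c̄)/v̄_k]`
(Görtz–Wedhorn 13.96 (2) for the hypersurface `V(r̄) ⊂ Spec A/(t)`), with its values.
[cite: GortzWedhorn2020, Prop. 13.96 (2) and p. 416] -/
theorem strictHyp_exists_equiv₂ (hc : IsQuasiRegular cc) [IsDomain (A ⧸ II)]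
    [IsDomain (A ⧸ Ideal.span {t})] (hvk : v k ∉ Ideal.span {t}) {r : A} {g : C} {n : ℕ}
    (hg : ψ r = w ^ n * g) (hgn : g ∉ Ideal.span {w} ⊔ Ideal.span {u'}) :
    ∃ E : (RR₁ ⧸ Ideal.span {Ψ g}) ≃+* RR₂[r], ∀ y : RR₁,
      E (Ideal.Quotient.mk (Ideal.span {Ψ g}) y) =
        blowupAlgebra.mapQuotient _ _ (Ideal.span {π₁ r}) y :=
  ⟨blowupAlgebra.quotientKerMapQuotientEquiv _ _ (strictHyp_factor t v k hg)
      (strictHyp_prime t v k hc hvk) (strictHyp_not_dvd t v k hc hgn),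
    fun y => blowupAlgebra.quotientKerMapQuotientEquiv_mk _ _ (strictHyp_factor t v k hg)
      (strictHyp_prime t v k hc hvk) (strictHyp_not_dvd t v k hc hgn) y⟩

/-- The reduction `C → (A/(t))[(c̄)/v̄_k] ⧸ (Ψ g)` is surjective with kernel `(u', g)`. [folklore] -/
theorem strictHyp_mk_comp_psi (hc : IsQuasiRegular cc) [IsDomain (A ⧸ II)] (g : C) :
    Function.Surjective ((Ideal.Quotient.mk (Ideal.span {Ψ g})).comp Ψ) ∧
      RingHom.ker ((Ideal.Quotient.mk (Ideal.span {Ψ g})).comp Ψ) = Ideal.span {u', g} := by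
  refine ⟨Ideal.Quotient.mk_surjective.comp
    ((blowupAlgebra.mapQuotient_surjective _ _ _).comp (Φ).surjective), ?_⟩
  rw [← RingHom.comap_ker, Ideal.mk_ker, strictHyp_comap_span t v k hc, Ideal.span_insert, sup_comm]

/-- `(A/(t))/(r̄) ≅ A/(t, r)`, with values. [folklore] -/
theorem strictHyp_quotQuot_equiv (r : A) :
    ∃ e : ((A ⧸ Ideal.span {t}) ⧸ Ideal.span {π₁ r}) ≃+* A ⧸ Ideal.span {t, r},
      ∀ a : A, e (π₂[r] (π₁ a)) = Ideal.Quotient.mk (Ideal.span {t, r}) a := by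
  have h1 : Ideal.span {π₁ r} = (Ideal.span {r}).map π₁ := by
    rw [Ideal.map_span π₁ {r}, Set.image_singleton]
  have h2 : Ideal.span {t} ⊔ Ideal.span {r} = Ideal.span {t, r} := (Ideal.span_insert t {r}).symm
  refine ⟨((Ideal.quotEquivOfEq h1).trans (DoubleQuot.quotQuotEquivQuotSup _ _)).trans
    (Ideal.quotEquivOfEq h2), fun a => ?_⟩
  have h3 : DoubleQuot.quotQuotEquivQuotSup (Ideal.span {t}) (Ideal.span {r})
      (DoubleQuot.quotQuotMk (Ideal.span {t}) (Ideal.span {r}) a) =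
      Ideal.Quotient.mk (Ideal.span {t} ⊔ Ideal.span {r}) a :=
    DoubleQuot.quotQuotEquivQuotSup_quotQuotMk _ _ a
  rw [RingEquiv.trans_apply, RingEquiv.trans_apply, Ideal.quotEquivOfEq_mk]
  rw [DoubleQuot.quotQuotMk, RingHom.comp_apply] at h3
  rw [h3, Ideal.quotEquivOfEq_mk]

/-- `(A/(t, r))[(c̄)/v̄_k]` is a domain when `A/(t, r)` is and `v_k ∉ (t, r)`; and then
`v̄_k ≠ 0` there. [cite: GortzWedhorn2020, (13.19)] -/
theorem strictHyp_isDomain_target₂ (r : A) [IsDomain (A ⧸ Ideal.span {t, r})]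
    (hvkr : v k ∉ Ideal.span {t, r}) :
    IsDomain RR₂[r] ∧ algebraMap ((A ⧸ Ideal.span {t}) ⧸ Ideal.span {π₁ r}) RR₂[r]
      (π₂[r] (π₁ (cc (Fin.succ k)))) ≠ 0 := by
  obtain ⟨e, he⟩ := strictHyp_quotQuot_equiv t r
  haveI : IsDomain ((A ⧸ Ideal.span {t}) ⧸ Ideal.span {π₁ r}) :=
    MulEquiv.isDomain (A ⧸ Ideal.span {t, r}) e.toMulEquiv
  have hne : π₂[r] (π₁ (cc (Fin.succ k))) ≠ 0 := by
    intro h0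
    have h1 := he (cc (Fin.succ k))
    rw [h0, map_zero, eq_comm, Ideal.Quotient.eq_zero_iff_mem, Fin.cons_succ] at h1
    exact hvkr h1
  haveI : IsDomain (Localization.Away (π₂[r] (π₁ (cc (Fin.succ k))))) :=
    IsLocalization.isDomain_localization (powers_le_nonZeroDivisors_of_noZeroDivisors hne)
  refine ⟨inferInstance, fun h0 => hne ?_⟩
  have h4 := congrArg Subtype.val h0
  rw [Subalgebra.coe_algebraMap, ZeroMemClass.coe_zero] at h4
  exact IsLocalization.injective (Localization.Away (π₂[r] (π₁ (cc (Fin.succ k)))))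
    (powers_le_nonZeroDivisors_of_noZeroDivisors hne) (by rw [h4, map_zero])

/-- **The strict transform of the hypersurface `V(r)`, cut by the strict transform `V(u')` of the
old exceptional divisor, is integral chart by chart**: if `φ(r) = wⁿ g`, `g ∉ (w, u')`, `A/(c)`,
`A/(t)`, `A/(t, r)` are domains and `v_k ∉ (t)`, `v_k ∉ (t, r)`, then `C ⧸ (u', g)` is a domain
(`≅ (A/(t, r))[(c̄)/v̄_k]`). [cite: GortzWedhorn2020, Prop. 13.96 (2) and p. 416] -/
theorem strictHyp_isDomain_quot_pair (hc : IsQuasiRegular cc) [IsDomain (A ⧸ II)]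
    [IsDomain (A ⧸ Ideal.span {t})] (hvk : v k ∉ Ideal.span {t}) {r : A} {g : C} {n : ℕ}
    (hg : ψ r = w ^ n * g) (hgn : g ∉ Ideal.span {w} ⊔ Ideal.span {u'})
    [IsDomain (A ⧸ Ideal.span {t, r})] (hvkr : v k ∉ Ideal.span {t, r}) :
    IsDomain (C ⧸ Ideal.span {u', g}) := by
  obtain ⟨E₂, -⟩ := strictHyp_exists_equiv₂ t v k hc hvk hg hgn
  obtain ⟨hΩ₀s, hΩ₀k⟩ := strictHyp_mk_comp_psi t v k hc g
  obtain ⟨hD, -⟩ := strictHyp_isDomain_target₂ t v k r hvkr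
  haveI : IsDomain (RR₁ ⧸ Ideal.span {Ψ g}) := MulEquiv.isDomain _ E₂.toMulEquiv
  exact MulEquiv.isDomain _
    ((Ideal.quotEquivOfEq hΩ₀k.symm).trans (RingHom.quotientKerEquivOfSurjective hΩ₀s)).toMulEquiv

/-- **… and the new exceptional divisor does not contain it: `w ∉ (u', g)`** (`w ↦ v̄_k ≠ 0` in
`(A/(t, r))[(c̄)/v̄_k]`). [cite: GortzWedhorn2020, Prop. 13.96 (2) and p. 416] -/
theorem strictHyp_chartBase_notMem_pair (hc : IsQuasiRegular cc) [IsDomain (A ⧸ II)]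
    [IsDomain (A ⧸ Ideal.span {t})] (hvk : v k ∉ Ideal.span {t}) {r : A} {g : C} {n : ℕ}
    (hg : ψ r = w ^ n * g) (hgn : g ∉ Ideal.span {w} ⊔ Ideal.span {u'})
    [IsDomain (A ⧸ Ideal.span {t, r})] (hvkr : v k ∉ Ideal.span {t, r}) :
    w ∉ Ideal.span {u', g} := by
  obtain ⟨E₂, hE₂⟩ := strictHyp_exists_equiv₂ t v k hc hvk hg hgn
  obtain ⟨-, hΩ₀k⟩ := strictHyp_mk_comp_psi t v k hc g
  obtain ⟨-, hne⟩ := strictHyp_isDomain_target₂ t v k r hvkr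
  intro hw
  rw [← hΩ₀k, RingHom.mem_ker] at hw
  have hw' : Ideal.Quotient.mk (Ideal.span {Ψ g}) (Ψ w) = 0 := hw
  have h1 := hE₂ (Ψ w)
  have h0 : E₂ 0 = 0 := RingEquiv.map_zero E₂
  -- (no `rw` inside `h1`: abstracting `Ψ w` there is prohibitively slow)
  have h3 : blowupAlgebra.mapQuotient _ _ (Ideal.span {π₁ r}) (Ψ w) =
      algebraMap ((A ⧸ Ideal.span {t}) ⧸ Ideal.span {π₁ r}) RR₂[r] (π₂[r] (π₁ (cc (Fin.succ k)))) :=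
    (congrArg (fun y => blowupAlgebra.mapQuotient _ _ (Ideal.span {π₁ r}) y)
      (strictHyp_psi_w t v k)).trans (blowupAlgebra.mapQuotient_algebraMap _ _ _ _)
  exact hne (h3.symm.trans (h1.symm.trans ((congrArg (fun y => E₂ y) hw').trans h0)))

end StrictHypersurface

end ConeRung

end Summit.ResolutionOfSingularities.ResolutionOfSingularities.Theorems

end
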